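import Summits.ResolutionOfSingularities.ResolutionOfSingularities.Theorems.PurelyInseparableDim4ExceptionalLength
import HarnessLib
import HarnessLib.Audit.Tags

/-!
# Purely inseparable dim 4 — the EXCEPTIONAL STAIRCASE: transport of Hasse-ideal monomials across a point blow-up

Sequel of `PurelyInseparableDim4ExceptionalLength` (master law / unit cancellation, p662098).  CARD I-3-12
ADDENDUM 2, law **(S1)** of seat idea-3 (cell `res-dim4-pi`), in typed, def-free form and slightly more generally
(ANY monomial, not only monomials in the exceptional coordinates):

for a presented state `s` of order `≥ p`, a chart `k`, a point `b` of the exceptional hyperplane (`b_k = 0`), the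
CLEANED transform `F' = (CentreBlowup.step p univ k b s).F`, and an exponent `A ≠ 0`:

  `x^A ∈ J_p⁺(F) + 𝔪₀^M  ⟹  x_k^{|A| − 1} · ∏_{c ≠ k, b_c = 0} x_c^{A_c} ∈ J_p⁺(F') + 𝔪₀^{M − 1}`

(`monomial_transport`; all-levels form `forall_monomial_transport`).  Mechanism: the chart substitution sends
`x^A` to `x_k^{|A|} · ∏_{c ≠ k} (x_c + b_c)^{A_c}`; the factors with `b_c ≠ 0` form a polynomial with non-zero
constant term; the master law `ExceptionalLength.X_pow_mul_mem_of_aeval_eq` cancels one `x_k`, and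
`ExceptionalLength.mem_sup_pow_of_mul_mem` cancels the unit.  Read on the exceptional coordinates through the point
(idea-3: `S` = components through the point, `𝓜(F) = {A ∈ ℕ^S : x^A ∈ Ĵ⁺(F)}`), this is the Hasse-ideal analogue of
the frame's exceptional-exponent transport, with «−1 on the new chart coordinate»: the surviving old components are
exactly those with `b_c = 0`; law (Λ1) (`…ExceptionalLengthFree`) is the case `A = ℓ·e_i` with `k = i ∨ b_i ≠ 0`, and
at a SATELLITE point (`k ≠ i`, `b_i = 0`) the transported monomial is the mixed `x_k^{ℓ−1} x_i^{ℓ}`.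

[cite: Kollar2007, (3.75.1)–(3.75.3) and Theorem 3.76 (derivative ideals under blow-up; char p, m = p)]
OURS · counted 0 · nothing here proves `NoWideTrap`, `NoIsolatedTrap 3 3`, or resolution of singularities in
dimension `≥ 4` / characteristic `p`.  Supports stmt-ResolutionOfSingularities-16155 (helper).
bears_on: LADDER-RESOLUTION:D157-DOOR2 (res-dim4-pi · E2(3,3) wide core · I-3-12 (S1)).
-/

set_option linter.dupNamespace false -- mandated namespace of this single-conjunct summit

namespace Summit.ResolutionOfSingularities.ResolutionOfSingularities.Theorems.PIDim4

namespace ExceptionalLength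

open MvPolynomial Finset
open Literature.AlgebraicGeometry
open Literature.AlgebraicGeometry.Resolution

variable {K : Type} [Field K]

/-! ## 1. The chart substitution on a monomial -/

/-- **`σ_{k,b}^*(x^A) = x_k^{|A|} · ∏_{c ≠ k} (x_c + b_c)^{A_c}`** (`b_k` is not used: the `k`-th factor is `x_k`).
[folklore] -/
theorem aeval_chart_monomial (k : Fin 4) (b : Fin 4 → K) (A : Fin 4 →₀ ℕ) :
    aeval (fun i => if i = k then (X k : MvPolynomial (Fin 4) K) else X k * (X i + C (b i)))
        (monomial A (1 : K)) =
      X k ^ A.degree * ∏ c ∈ Finset.univ.erase k, (X c + C (b c)) ^ A c := by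
  classical
  rw [aeval_monomial, map_one, one_mul, Finsupp.prod_fintype _ _ (fun i => pow_zero _),
    ← Finset.mul_prod_erase Finset.univ _ (Finset.mem_univ k)]
  simp only [if_true]
  have h1 : ∏ c ∈ Finset.univ.erase k,
      (if c = k then (X k : MvPolynomial (Fin 4) K) else X k * (X c + C (b c))) ^ A c =
      X k ^ (∑ c ∈ Finset.univ.erase k, A c) * ∏ c ∈ Finset.univ.erase k, (X c + C (b c)) ^ A c := by
    rw [← Finset.prod_pow_eq_pow_sum, ← Finset.prod_mul_distrib]
    refine Finset.prod_congr rfl fun c hc => ?_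
    rw [if_neg (Finset.ne_of_mem_erase hc), mul_pow]
  have hdeg : A.degree = A k + ∑ c ∈ Finset.univ.erase k, A c := by
    rw [BlowupHasse.degree_eq_sum_univ, ← Finset.add_sum_erase _ _ (Finset.mem_univ k)]
  rw [h1, ← mul_assoc, ← pow_add, ← hdeg]

/-- The product `∏_{c ≠ k} (x_c + b_c)^{A_c}` splits into the SURVIVING exceptional part `∏_{c ≠ k, b_c = 0} x_c^{A_c}`
times a polynomial with non-zero constant term `∏_{c ≠ k, b_c ≠ 0} (x_c + b_c)^{A_c}`. [folklore] -/
theorem prod_erase_eq_prod_filter_mul [DecidableEq K] (k : Fin 4) (b : Fin 4 → K) (A : Fin 4 →₀ ℕ) :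
    ∏ c ∈ Finset.univ.erase k, ((X c : MvPolynomial (Fin 4) K) + C (b c)) ^ A c =
      (∏ c ∈ (Finset.univ.erase k).filter (fun c => b c = 0), (X c : MvPolynomial (Fin 4) K) ^ A c) *
        ∏ c ∈ (Finset.univ.erase k).filter (fun c => ¬ b c = 0), ((X c : MvPolynomial (Fin 4) K) + C (b c)) ^ A c := by
  rw [← Finset.prod_filter_mul_prod_filter_not (Finset.univ.erase k) (fun c => b c = 0)]
  congr 1
  refine Finset.prod_congr rfl fun c hc => ?_
  rw [(Finset.mem_filter.mp hc).2, C_0, add_zero]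

/-- The unit factor has non-zero constant term `∏ b_c^{A_c}`. [folklore] -/
theorem constantCoeff_prod_filter_ne_zero [DecidableEq K] (k : Fin 4) (b : Fin 4 → K) (A : Fin 4 →₀ ℕ) :
    constantCoeff (∏ c ∈ (Finset.univ.erase k).filter (fun c => ¬ b c = 0),
      ((X c : MvPolynomial (Fin 4) K) + C (b c)) ^ A c) ≠ 0 := by
  rw [map_prod]
  refine Finset.prod_ne_zero_iff.mpr fun c hc => ?_
  rw [map_pow, map_add, constantCoeff_X, constantCoeff_C, zero_add]
  exact pow_ne_zero _ (Finset.mem_filter.mp hc).2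

/-! ## 2. (S1): the exceptional staircase -/

/-- **(S1) Transport of a Hasse-ideal monomial across a point blow-up** (CARD I-3-12 ADD. 2): for a state of
order `≥ p`, a chart `k`, a point `b` with `b_k = 0` and an exponent `A ≠ 0`,
`x^A ∈ J_p⁺(F) + 𝔪₀^M ⟹ x_k^{|A|−1} · ∏_{c ≠ k, b_c = 0} x_c^{A_c} ∈ J_p⁺(F') + 𝔪₀^{M−1}`, `F'` the cleaned
transform.  ANY `b` on the exceptional hyperplane; no equimultiplicity, no isolation.
[cite: Kollar2007, Theorem 3.76 (char p, m = p)] -/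
theorem monomial_transport (p : ℕ) [Fact p.Prime] [CharP K p] [DecidableEq K] (s : State K)
    (k : Fin 4) (b : Fin 4 → K) (hbk : b k = 0)
    (hord : (p : ℕ∞) ≤ CentreBlowup.ordAlong Finset.univ s.F) (A : Fin 4 →₀ ℕ) (hA : 1 ≤ A.degree)
    {M : ℕ} (hx : (monomial A (1 : K)) ∈ singLocusIdeal p s.F ⊔ originIdeal K ^ M) :
    (X k : MvPolynomial (Fin 4) K) ^ (A.degree - 1) *
        ∏ c ∈ (Finset.univ.erase k).filter (fun c => b c = 0), (X c : MvPolynomial (Fin 4) K) ^ A c ∈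
      singLocusIdeal p (CentreBlowup.step p Finset.univ k b s).F ⊔ originIdeal K ^ (M - 1) := by
  set m : MvPolynomial (Fin 4) K :=
    ∏ c ∈ (Finset.univ.erase k).filter (fun c => b c = 0), (X c : MvPolynomial (Fin 4) K) ^ A c with hm
  set u : MvPolynomial (Fin 4) K :=
    ∏ c ∈ (Finset.univ.erase k).filter (fun c => ¬ b c = 0), ((X c : MvPolynomial (Fin 4) K) + C (b c)) ^ A c
    with hu
  have hσ : aeval (fun i => if i = k then (X k : MvPolynomial (Fin 4) K) else X k * (X i + C (b i)))
      (monomial A (1 : K)) = X k ^ A.degree * (m * u) := by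
    rw [aeval_chart_monomial, prod_erase_eq_prod_filter_mul]
  have h1 := X_pow_mul_mem_of_aeval_eq p s k b hbk hord hA hx hσ
  have h2 : X k ^ (A.degree - 1) * m * u ∈
      singLocusIdeal p (CentreBlowup.step p Finset.univ k b s).F ⊔ originIdeal K ^ (M - 1) := by
    rw [mul_assoc]
    exact sup_le_sup_left (span_X_pow_le_originIdeal_pow k (M - 1)) _ h1
  exact mem_sup_pow_of_mul_mem (constantCoeff_prod_filter_ne_zero k b A) h2

/-- **(S1), all levels at once**: `(∀ M, x^A ∈ J_p⁺(F) + 𝔪₀^M) ⟹ ∀ M, x_k^{|A|−1} · ∏_{c ≠ k, b_c = 0} x_c^{A_c} ∈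
J_p⁺(F') + 𝔪₀^M` — on the Hasse FAT POINTS: `x^A ∈ Ĵ⁺(F) ⟹ x_k^{|A|−1} ∏_{b_c = 0} x_c^{A_c} ∈ Ĵ⁺(F')`.
[cite: Kollar2007, Theorem 3.76 (char p, m = p)] -/
theorem forall_monomial_transport (p : ℕ) [Fact p.Prime] [CharP K p] [DecidableEq K] (s : State K)
    (k : Fin 4) (b : Fin 4 → K) (hbk : b k = 0)
    (hord : (p : ℕ∞) ≤ CentreBlowup.ordAlong Finset.univ s.F) (A : Fin 4 →₀ ℕ) (hA : 1 ≤ A.degree)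
    (hx : ∀ M : ℕ, (monomial A (1 : K)) ∈ singLocusIdeal p s.F ⊔ originIdeal K ^ M) (M : ℕ) :
    (X k : MvPolynomial (Fin 4) K) ^ (A.degree - 1) *
        ∏ c ∈ (Finset.univ.erase k).filter (fun c => b c = 0), (X c : MvPolynomial (Fin 4) K) ^ A c ∈
      singLocusIdeal p (CentreBlowup.step p Finset.univ k b s).F ⊔ originIdeal K ^ M := by
  have h := monomial_transport p s k b hbk hord A hA (hx (M + 1))
  rwa [Nat.add_sub_cancel] at h

/-! ## 3. The two-coordinate readings: E-free and SATELLITE moves -/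

/-- **Satellite transport.**  At a SATELLITE move with respect to `E = {x_i = 0}` — chart `k ≠ i` at a point `b`
with `b_k = 0` and `b_i = 0` (the new point lies on the strict transform of `E`) — a pure power `x_i^ℓ` of the old
exceptional coordinate in `J_p⁺(F) + 𝔪₀^M` becomes the MIXED monomial `x_k^{ℓ−1} · x_i^{ℓ}` in
`J_p⁺(F') + 𝔪₀^{M−1}` (both exceptional coordinates through the new point). [cite: Kollar2007, Theorem 3.76 (char p, m = p)] -/
theorem X_pow_mul_X_pow_mem_of_satellite (p : ℕ) [Fact p.Prime] [CharP K p] [DecidableEq K] (s : State K)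
    {k i : Fin 4} (hki : k ≠ i) (b : Fin 4 → K) (hbk : b k = 0) (hbi : b i = 0)
    (hord : (p : ℕ∞) ≤ CentreBlowup.ordAlong Finset.univ s.F) {ℓ M : ℕ} (hℓ : 1 ≤ ℓ)
    (hx : (X i : MvPolynomial (Fin 4) K) ^ ℓ ∈ singLocusIdeal p s.F ⊔ originIdeal K ^ M) :
    (X k : MvPolynomial (Fin 4) K) ^ (ℓ - 1) * X i ^ ℓ ∈
      singLocusIdeal p (CentreBlowup.step p Finset.univ k b s).F ⊔ originIdeal K ^ (M - 1) := by
  have hσ : aeval (fun c => if c = k then (X k : MvPolynomial (Fin 4) K) else X k * (X c + C (b c)))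
      ((X i : MvPolynomial (Fin 4) K) ^ ℓ) = X k ^ ℓ * (X i ^ ℓ * 1) := by
    rw [map_pow, aeval_X, if_neg (Ne.symm hki), hbi, C_0, add_zero, mul_pow, mul_one]
  have h1 := X_pow_mul_mem_of_aeval_eq p s k b hbk hord hℓ hx hσ
  have h2 : (X k : MvPolynomial (Fin 4) K) ^ (ℓ - 1) * X i ^ ℓ * 1 ∈
      singLocusIdeal p (CentreBlowup.step p Finset.univ k b s).F ⊔ originIdeal K ^ (M - 1) := by
    rw [mul_assoc]
    exact sup_le_sup_left (span_X_pow_le_originIdeal_pow k (M - 1)) _ h1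
  rwa [mul_one] at h2

/-- **Transport of a mixed monomial in two exceptional coordinates** `x_i^α x_l^γ` (`i ≠ l`), move in chart `k`
at `b` (`b_k = 0`), general position of `b` encoded by the two survival bits: the transported monomial is
`x_k^{α+γ−1} · x_i^{[k ≠ i ∧ b_i = 0]·α} · x_l^{[k ≠ l ∧ b_l = 0]·γ}`. [cite: Kollar2007, Theorem 3.76 (char p, m = p)] -/
theorem pair_transport (p : ℕ) [Fact p.Prime] [CharP K p] [DecidableEq K] (s : State K)
    (k : Fin 4) (b : Fin 4 → K) (hbk : b k = 0)
    (hord : (p : ℕ∞) ≤ CentreBlowup.ordAlong Finset.univ s.F) {i l : Fin 4} (hil : i ≠ l) {α γ M : ℕ}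
    (hαγ : 1 ≤ α + γ)
    (hx : (X i : MvPolynomial (Fin 4) K) ^ α * X l ^ γ ∈ singLocusIdeal p s.F ⊔ originIdeal K ^ M) :
    (X k : MvPolynomial (Fin 4) K) ^ (α + γ - 1) *
        ((X i : MvPolynomial (Fin 4) K) ^ (if k ≠ i ∧ b i = 0 then α else 0) *
          X l ^ (if k ≠ l ∧ b l = 0 then γ else 0)) ∈
      singLocusIdeal p (CentreBlowup.step p Finset.univ k b s).F ⊔ originIdeal K ^ (M - 1) := by
  classical
  -- the exponent `A = α e_i + γ e_l`
  set A : Fin 4 →₀ ℕ := Finsupp.single i α + Finsupp.single l γ with hA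
  have hAi : A i = α := by
    rw [hA, Finsupp.add_apply, Finsupp.single_eq_same, Finsupp.single_eq_of_ne hil, add_zero]
  have hAl : A l = γ := by
    rw [hA, Finsupp.add_apply, Finsupp.single_eq_of_ne (Ne.symm hil), Finsupp.single_eq_same, zero_add]
  have hAc : ∀ c, c ≠ i → c ≠ l → A c = 0 := fun c hci hcl => by
    rw [hA, Finsupp.add_apply, Finsupp.single_eq_of_ne hci, Finsupp.single_eq_of_ne hcl, add_zero]
  have hdeg : A.degree = α + γ := by
    rw [hA, map_add, Finsupp.degree_single, Finsupp.degree_single]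
  have hmono : (monomial A (1 : K)) = (X i : MvPolynomial (Fin 4) K) ^ α * X l ^ γ := by
    rw [hA, X_pow_eq_monomial, X_pow_eq_monomial, monomial_mul, mul_one]
  have hx' : (monomial A (1 : K)) ∈ singLocusIdeal p s.F ⊔ originIdeal K ^ M := by rwa [hmono]
  have h := monomial_transport p s k b hbk hord A (by rw [hdeg]; exact hαγ) hx'
  rw [hdeg] at h
  -- identify the surviving product
  have hprod : ∏ c ∈ (Finset.univ.erase k).filter (fun c => b c = 0), (X c : MvPolynomial (Fin 4) K) ^ A c =
      (X i : MvPolynomial (Fin 4) K) ^ (if k ≠ i ∧ b i = 0 then α else 0) *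
        X l ^ (if k ≠ l ∧ b l = 0 then γ else 0) := by
    -- all factors other than `i`, `l` are `1`
    have hsub : ∀ c ∈ (Finset.univ.erase k).filter (fun c => b c = 0), c ∉ ({i, l} : Finset (Fin 4)) →
        (X c : MvPolynomial (Fin 4) K) ^ A c = 1 := by
      intro c _ hc
      rw [Finset.mem_insert, Finset.mem_singleton, not_or] at hc
      rw [hAc c hc.1 hc.2, pow_zero]
    rw [← Finset.prod_filter_mul_prod_filter_not _ (fun c => c ∈ ({i, l} : Finset (Fin 4)))]
    rw [Finset.prod_eq_one (s := ((Finset.univ.erase k).filter (fun c => b c = 0)).filter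
      (fun c => ¬ c ∈ ({i, l} : Finset (Fin 4)))) (fun c hc => by
        have hc' := Finset.mem_filter.mp hc
        exact hsub c hc'.1 hc'.2), mul_one]
    -- the factor at `i`
    have hi : ∏ c ∈ ((Finset.univ.erase k).filter (fun c => b c = 0)).filter
        (fun c => c ∈ ({i, l} : Finset (Fin 4))), (X c : MvPolynomial (Fin 4) K) ^ A c =
        (X i : MvPolynomial (Fin 4) K) ^ (if k ≠ i ∧ b i = 0 then α else 0) *
          X l ^ (if k ≠ l ∧ b l = 0 then γ else 0) := by
      rw [Finset.filter_filter]
      have hset : ((Finset.univ.erase k).filter fun c => b c = 0 ∧ c ∈ ({i, l} : Finset (Fin 4))) =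
          (if k ≠ i ∧ b i = 0 then {i} else ∅) ∪ (if k ≠ l ∧ b l = 0 then {l} else ∅) := by
        ext c
        simp only [Finset.mem_filter, Finset.mem_erase, Finset.mem_univ, and_true, Finset.mem_insert,
          Finset.mem_singleton, Finset.mem_union]
        constructor
        · rintro ⟨hck, hbc, hc | hc⟩
          · subst hc
            left
            rw [if_pos ⟨Ne.symm hck, hbc⟩]
            exact Finset.mem_singleton_self _
          · subst hc
            right
            rw [if_pos ⟨Ne.symm hck, hbc⟩]
            exact Finset.mem_singleton_self _
        · rintro (hc | hc)
          · by_cases h' : k ≠ i ∧ b i = 0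
            · rw [if_pos h'] at hc
              rw [Finset.mem_singleton] at hc
              subst hc
              exact ⟨Ne.symm h'.1, h'.2, Or.inl rfl⟩
            · rw [if_neg h'] at hc
              exact absurd hc (Finset.notMem_empty _)
          · by_cases h' : k ≠ l ∧ b l = 0
            · rw [if_pos h'] at hc
              rw [Finset.mem_singleton] at hc
              subst hc
              exact ⟨Ne.symm h'.1, h'.2, Or.inr rfl⟩
            · rw [if_neg h'] at hc
              exact absurd hc (Finset.notMem_empty _)
      rw [hset]
      have hdisj : Disjoint (if k ≠ i ∧ b i = 0 then ({i} : Finset (Fin 4)) else ∅)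
          (if k ≠ l ∧ b l = 0 then ({l} : Finset (Fin 4)) else ∅) := by
        split_ifs
        · exact Finset.disjoint_singleton.mpr hil
        · exact Finset.disjoint_empty_right _
        · exact Finset.disjoint_empty_left _
        · exact Finset.disjoint_empty_left _
      rw [Finset.prod_union hdisj]
      congr 1
      · split_ifs with h'
        · rw [Finset.prod_singleton, hAi]
        · rw [Finset.prod_empty, pow_zero]
      · split_ifs with h'
        · rw [Finset.prod_singleton, hAl]
        · rw [Finset.prod_empty, pow_zero]
    rw [hi]
  rwa [hprod] at h

end ExceptionalLength

end Summit.ResolutionOfSingularities.ResolutionOfSingularities.Theorems.PIDim4
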